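import Literature.NumberTheory.Transcendental.ManyCurveThetaOrbits
import Literature.NumberTheory.Transcendental.ThetaLinealityStructure
import HarnessLib

/-!
# The lineality space of a `Θ`-closed subgroup of `Lie M_κ` (family theta model)

Topic `Literature/NumberTheory/Transcendental`; unit
`provefact-Literature.NumberTheory.Transcendental.H-0a3eb64689` (fact
`Literature.NumberTheory.Transcendental.HuberWustholzManyCurvePeriods`, `ManyCurvePeriods.lean`).
It introduces NO named fact. Lattice-family counterpart of the one-lattice
`ThetaLinealityStructure.lean` for the theta model of `ManyCurveTheta.lean` (lattice family
`L : 𝓙 → PeriodPair`, class map `cls : γ → 𝓙`). Let `H ⊆ V = Lie M_κ,ℂ = ℂ^β × ℂ^γ × ℂ^δ` be a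
closed additive subgroup for the `Θ`-topology of a theta model and `𝔥 = 𝒯(H)` its lineality
space. The periodicity lemmas of `ManyCurveThetaOrbits.lean` yield:

* `sEmb_sPart_mem_linSpace`, `yEmb_yPart_mem_linSpace`, `mem_linSpace_iff_of_z_eq_zero` — the part
  of `𝔥` over `z' = 0` is the product `yDir 𝔥 × 0 × sDir 𝔥`;
* `mem_yDir_of_forall_int`, `mem_yDir_iff_forall_yRelQ` — the torus directions form a RATIONAL
  subspace (Artin move);
* `sEmb_sub_mem_linSpace` — the lattice move (lattice of block `b` = `Λ_{cls b}`);
* `kappaVec_mem_of_int_lift`, `coords_omega_smul_yPart_mem`, `kappaVec_mem_and_zEmb_mem` — for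
  integer vectors `v` of `𝔷₀ = z'(𝔥)` SUPPORTED IN ONE CLASS `i` (so that `ω_j(Λ_i) v ∈ Λ_γ`):
  the two lattice moves at `ω₁(Λ_i)σ`, `ω₂(Λ_i)σ` and the Legendre relation of `Λ_i` give the
  compatibility `(0, 0, κv) ∈ 𝔥` and the splitting `(0, v, 0) ∈ 𝔥`; if `𝔷₀` is spanned by such
  classwise integer vectors (the classwise saturation of the sequel), this holds for all `ζ ∈ 𝔷₀`.

The generic blocks (`GaGmE.Std.yDir`, `sDir`, `zProj`, `zEmb`, `kappaVec`, `intVec`, `yRelQ`,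
`eq_zero_of_mul_omega_mem_two_pi_I`, …) of the one-lattice file are reused. Everything is PROVED.

## References

* Yu. V. Nesterenko, P. Philippon (eds.), *Introduction to Algebraic Independence Theory*,
  LNM 1752, Springer 2001, Ch. 11 (D. Roy), Thm. 4.1. [NesterenkoPhilippon2001]
* D. Bertrand, P. Philippon, *Sous-groupes algébriques de groupes algébriques commutatifs*,
  Illinois J. Math. 32 (1988), 263–280. [folklore]
* A. Huber, G. Wüstholz, *Transcendence and Linear Relations of 1-Periods*, Cambridge Tracts 227,
  CUP 2022, Thm. 15.3 (1). [HuberWustholz2022]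
-/

noncomputable section

open Complex MvPolynomial Module
open scoped PeriodPair

namespace Literature.NumberTheory.Transcendental

namespace GaGmEFam

namespace Std

open GaGmE (Kbar)
open GaGmE.Std (iy iz is coords coords_iy coords_iz coords_is coords_add coords_smul coords_sub yPart zPart sPart
  yEmb sEmb ThetaIdx ω₁_mul_η₂_sub_ne_zero charPerp mem_charPerp_iff eq_zero_of_forall_exp_mul_eq_one yDir sDir zProj mem_yDir_iff
  mem_sDir_iff kappaVec intVec eq_coords_add_of_z_eq_zero yRelQ mem_yRelQ_iff eq_zero_of_mul_omega_mem_two_pi_I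
  zEmb zEmb_apply kappaVecₗ kappaVecₗ_apply)

variable {𝓙 : Type} [DecidableEq 𝓙] {β γ δ : Type} [Fintype β] [Fintype γ] [Fintype δ] [DecidableEq γ]
variable (L : 𝓙 → PeriodPair) (cls : γ → 𝓙) (κM : δ → γ → Kbar)

/-! ### Directions of the lineality space from vanishing of forms -/

section Model

variable {N : ℕ} (M : AnalyticGroupModel (β ⊕ (γ ⊕ δ) → ℂ) N) (e : Option β × ThetaIdx γ δ ≃ Fin (N + 1))
variable (hΘ : ∀ J w, M.Θ (e J) w = theta L cls κM J w)
include hΘ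

omit [DecidableEq 𝓙] in
/-- **Test for the lineality space of a closed subgroup**: `x ∈ 𝒯(H)` as soon as every form
vanishing on `H` vanishes at `w + t x` for all `w ∈ H`, `t ∈ ℂ`. [folklore] -/
theorem mem_linSpace_of_forall_thetaEval {H : AddSubgroup (β ⊕ (γ ⊕ δ) → ℂ)}
    (hH : M.IsClosedG (H : Set (β ⊕ (γ ⊕ δ) → ℂ))) {x : β ⊕ (γ ⊕ δ) → ℂ}
    (hx : ∀ (D : ℕ) (P : MvPolynomial (Option β × ThetaIdx γ δ) ℂ), P.IsHomogeneous D →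
      (∀ v ∈ H, thetaEval L cls κM P v = 0) → ∀ w ∈ H, ∀ t : ℂ, thetaEval L cls κM P (w + t • x) = 0) :
    x ∈ AnalyticGroupModel.linSpace (H : Set (β ⊕ (γ ⊕ δ) → ℂ)) := by
  intro w hw t
  exact mem_of_isClosedG L cls κM M e hΘ hH fun D P hP hvan => hx D P hP hvan w hw t

omit [DecidableEq 𝓙] in
/-- **The vector part splits off**: for `r = (y, 0, s) ∈ 𝒯(H)`, `(0, 0, s) ∈ 𝒯(H)` — periodicity
lemma along `ℕ r` with `θ = 0`. [folklore] -/
theorem sEmb_sPart_mem_linSpace {H : AddSubgroup (β ⊕ (γ ⊕ δ) → ℂ)}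
    (hH : M.IsClosedG (H : Set (β ⊕ (γ ⊕ δ) → ℂ))) {r : β ⊕ (γ ⊕ δ) → ℂ}
    (hr : r ∈ AnalyticGroupModel.linSpace (H : Set (β ⊕ (γ ⊕ δ) → ℂ))) (hrz : ∀ b, r (iz b) = 0) :
    coords (0 : β → ℂ) (0 : γ → ℂ) (sPart r) ∈ AnalyticGroupModel.linSpace (H : Set (β ⊕ (γ ⊕ δ) → ℂ)) := by
  refine mem_linSpace_of_forall_thetaEval L cls κM M e hΘ hH fun D P _ hvan w hw t => ?_
  have h := thetaEval_eq_zero_of_forall_natMul L cls κM P (w := w) hrz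
    (fun n => hvan _ (hr w hw n)) (θ := 0) (fun q _ => by simp) t
  have hv : t • coords (0 : β → ℂ) (0 : γ → ℂ) (sPart r) = coords (0 : β → ℂ) (0 : γ → ℂ) fun e' => t * r (is e') := by
    rw [← coords_smul, smul_zero, smul_zero]
    rfl
  rw [hv]
  exact h

omit [DecidableEq 𝓙] in
/-- **The torus part splits off**: for `r = (y, 0, s) ∈ 𝒯(H)`, `(y, 0, 0) ∈ 𝒯(H)`. [folklore] -/
theorem yEmb_yPart_mem_linSpace {H : AddSubgroup (β ⊕ (γ ⊕ δ) → ℂ)}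
    (hH : M.IsClosedG (H : Set (β ⊕ (γ ⊕ δ) → ℂ))) {r : β ⊕ (γ ⊕ δ) → ℂ}
    (hr : r ∈ AnalyticGroupModel.linSpace (H : Set (β ⊕ (γ ⊕ δ) → ℂ))) (hrz : ∀ b, r (iz b) = 0) :
    coords (yPart r) (0 : γ → ℂ) (0 : δ → ℂ) ∈ AnalyticGroupModel.linSpace (H : Set (β ⊕ (γ ⊕ δ) → ℂ)) := by
  have hs := sEmb_sPart_mem_linSpace L cls κM M e hΘ hH hr hrz
  have : coords (yPart r) (0 : γ → ℂ) (0 : δ → ℂ) = r - coords (0 : β → ℂ) (0 : γ → ℂ) (sPart r) := by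
    rw [eq_sub_iff_add_eq]
    exact (eq_coords_add_of_z_eq_zero hrz).symm
  rw [this]
  exact Submodule.sub_mem _ hr hs

omit [DecidableEq 𝓙] in
/-- The part of `𝒯(H)` over `z' = 0` is the product `yDir × 0 × sDir`. [folklore] -/
theorem mem_linSpace_iff_of_z_eq_zero {H : AddSubgroup (β ⊕ (γ ⊕ δ) → ℂ)}
    (hH : M.IsClosedG (H : Set (β ⊕ (γ ⊕ δ) → ℂ))) {r : β ⊕ (γ ⊕ δ) → ℂ} (hrz : ∀ b, r (iz b) = 0) :
    r ∈ AnalyticGroupModel.linSpace (H : Set (β ⊕ (γ ⊕ δ) → ℂ)) ↔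
      yPart r ∈ yDir (AnalyticGroupModel.linSpace (H : Set (β ⊕ (γ ⊕ δ) → ℂ))) ∧
        sPart r ∈ sDir (AnalyticGroupModel.linSpace (H : Set (β ⊕ (γ ⊕ δ) → ℂ))) := by
  constructor
  · intro hr
    exact ⟨yEmb_yPart_mem_linSpace L cls κM M e hΘ hH hr hrz, sEmb_sPart_mem_linSpace L cls κM M e hΘ hH hr hrz⟩
  · rintro ⟨hy, hs⟩
    rw [eq_coords_add_of_z_eq_zero hrz]
    exact Submodule.add_mem _ hy hs

/-! ### The torus directions form a rational subspace (Artin move) -/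

omit [DecidableEq 𝓙] in
/-- **Artin move for the lineality space**: every `θ` orthogonal to the integer characters trivial
on `yDir 𝒯(H)` is a torus direction of `𝒯(H)`. [folklore] -/
theorem mem_yDir_of_forall_int {H : AddSubgroup (β ⊕ (γ ⊕ δ) → ℂ)}
    (hH : M.IsClosedG (H : Set (β ⊕ (γ ⊕ δ) → ℂ))) {θ : β → ℂ}
    (hθ : ∀ q : β → ℤ, (∀ g ∈ yDir (AnalyticGroupModel.linSpace (H : Set (β ⊕ (γ ⊕ δ) → ℂ))),
      ∑ j, (q j : ℂ) * g j = 0) → ∑ j, (q j : ℂ) * θ j = 0) :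
    θ ∈ yDir (AnalyticGroupModel.linSpace (H : Set (β ⊕ (γ ⊕ δ) → ℂ))) := by
  set 𝔥 := AnalyticGroupModel.linSpace (H : Set (β ⊕ (γ ⊕ δ) → ℂ)) with h𝔥
  rw [mem_yDir_iff]
  refine mem_linSpace_of_forall_thetaEval L cls κM M e hΘ hH fun D P _ hvan w hw t => ?_
  -- the Artin move on the subgroup `yDir 𝔥`
  have hmem : t • θ ∈ charPerp (β := β) (yDir 𝔥).toAddSubgroup := by
    refine Submodule.smul_mem _ t ((mem_charPerp_iff).mpr fun q hq => hθ q fun g hg => ?_)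
    -- `e^{⟨q, g'⟩} = 1` on the subspace `yDir 𝔥` forces `⟨q, g⟩ = 0`
    have h2pi : ∀ c : ℂ, cexp (c * ∑ j, (q j : ℂ) * g j) = 1 := by
      intro c
      have := hq (c • g) (Submodule.smul_mem _ c hg)
      rw [← this]
      congr 1
      simp only [Pi.smul_apply, smul_eq_mul, Finset.mul_sum]
      exact Finset.sum_congr rfl fun j _ => by ring
    exact eq_zero_of_forall_exp_mul_eq_one h2pi
  have h := thetaEval_eq_zero_of_forall_mem_addSubgroup L cls κM P (w := w) (yDir 𝔥).toAddSubgroup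
    (fun g hg => hvan _ (by simpa using (mem_yDir_iff.mp hg) w hw 1)) hmem
  have hv : t • coords θ (0 : γ → ℂ) (0 : δ → ℂ) = coords (t • θ) (0 : γ → ℂ) (0 : δ → ℂ) := by
    rw [← coords_smul, smul_zero, smul_zero]
  rw [hv]
  exact h

omit [DecidableEq 𝓙] in
/-- **The torus directions of `𝒯(H)` are cut out by their rational relations.** [folklore] -/
theorem mem_yDir_iff_forall_yRelQ {H : AddSubgroup (β ⊕ (γ ⊕ δ) → ℂ)}
    (hH : M.IsClosedG (H : Set (β ⊕ (γ ⊕ δ) → ℂ))) (θ : β → ℂ) :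
    θ ∈ yDir (AnalyticGroupModel.linSpace (H : Set (β ⊕ (γ ⊕ δ) → ℂ))) ↔
      ∀ q ∈ yRelQ (yDir (AnalyticGroupModel.linSpace (H : Set (β ⊕ (γ ⊕ δ) → ℂ)))), ∑ j, (q j : ℂ) * θ j = 0 := by
  constructor
  · intro hθ q hq; exact hq θ hθ
  · intro h
    refine mem_yDir_of_forall_int L cls κM M e hΘ hH fun q hq => ?_
    have := h (fun j => (q j : ℚ)) (fun g hg => by simpa using hq g hg)
    simpa using this

/-! ### The lattice move: compatibility and splitting of the `E`-directions -/

omit [DecidableEq 𝓙] in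
/-- **The lattice move for the lineality space**: for `t ∈ 𝒯(H)` with lattice `E`-coordinates
`z'(t) = mω₁ + nω₂`, the corrected vector `(0, 0, s(t) - κ η(z'(t))) ∈ 𝒯(H)`. [folklore] -/
theorem sEmb_sub_mem_linSpace {H : AddSubgroup (β ⊕ (γ ⊕ δ) → ℂ)}
    (hH : M.IsClosedG (H : Set (β ⊕ (γ ⊕ δ) → ℂ))) {t : β ⊕ (γ ⊕ δ) → ℂ}
    (ht : t ∈ AnalyticGroupModel.linSpace (H : Set (β ⊕ (γ ⊕ δ) → ℂ))) (m n : γ → ℤ)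
    (htz : ∀ b, t (iz b) = (m b : ℂ) * (L (cls b)).ω₁ + (n b : ℂ) * (L (cls b)).ω₂) :
    coords (0 : β → ℂ) (0 : γ → ℂ)
        (fun e' => t (is e') - ∑ b, (κM e' b : ℂ) * ((m b : ℂ) * (L (cls b)).η₁ + (n b : ℂ) * (L (cls b)).η₂)) ∈
      AnalyticGroupModel.linSpace (H : Set (β ⊕ (γ ⊕ δ) → ℂ)) := by
  refine mem_linSpace_of_forall_thetaEval L cls κM M e hΘ hH fun D P hP hvan w hw τ => ?_
  have h := thetaEval_eq_zero_of_forall_natMul_lattice L cls κM hP (X := (H : Set _)) hvan m n htz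
    (fun k => ht w hw k) (θ := 0) (fun q _ => by simp) τ
  have hv : τ • coords (0 : β → ℂ) (0 : γ → ℂ)
      (fun e' => t (is e') - ∑ b, (κM e' b : ℂ) * ((m b : ℂ) * (L (cls b)).η₁ + (n b : ℂ) * (L (cls b)).η₂)) =
      coords (0 : β → ℂ) (0 : γ → ℂ)
      (fun e' => τ * (t (is e') - ∑ b, (κM e' b : ℂ) * ((m b : ℂ) * (L (cls b)).η₁ + (n b : ℂ) * (L (cls b)).η₂))) := by
    rw [← coords_smul, smul_zero, smul_zero]
    rfl
  rw [hv]
  exact h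

/-- **One integer vector of `𝔷₀`.** For `σ ∈ 𝒯(H)` with integer `E`-coordinates `v`:
`(0,0,κv) ∈ 𝒯(H)` and `(0,0,s(σ)) ∈ 𝒯(H)` (two lattice moves at `ω₁σ`, `ω₂σ` and the Legendre
relation). [folklore] -/
theorem kappaVec_mem_of_int_lift {H : AddSubgroup (β ⊕ (γ ⊕ δ) → ℂ)}
    (hH : M.IsClosedG (H : Set (β ⊕ (γ ⊕ δ) → ℂ))) {σ : β ⊕ (γ ⊕ δ) → ℂ}
    (hσ : σ ∈ AnalyticGroupModel.linSpace (H : Set (β ⊕ (γ ⊕ δ) → ℂ))) (v : γ → ℤ) {i : 𝓙}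
    (hvi : ∀ b, cls b ≠ i → v b = 0) (hσz : ∀ b, σ (iz b) = (v b : ℂ)) :
    coords (0 : β → ℂ) (0 : γ → ℂ) (kappaVec κM (intVec v)) ∈ AnalyticGroupModel.linSpace (H : Set (β ⊕ (γ ⊕ δ) → ℂ)) ∧
      coords (0 : β → ℂ) (0 : γ → ℂ) (sPart σ) ∈ AnalyticGroupModel.linSpace (H : Set (β ⊕ (γ ⊕ δ) → ℂ)) := by
  set 𝔥 := AnalyticGroupModel.linSpace (H : Set (β ⊕ (γ ⊕ δ) → ℂ)) with h𝔥
  set Λ := L i with hΛ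
  set D : ℂ := Λ.ω₁ * Λ.η₂ - Λ.ω₂ * Λ.η₁ with hD
  have hD0 : D ≠ 0 := ω₁_mul_η₂_sub_ne_zero Λ
  have hvf : ∀ (f : PeriodPair → ℂ) (b : γ), (v b : ℂ) * f (L (cls b)) = (v b : ℂ) * f Λ := by
    intro f b
    by_cases hb : cls b = i
    · rw [hΛ, ← hb]
    · rw [hvi b hb, Int.cast_zero, zero_mul, zero_mul]
  set c₁ : δ → ℂ := fun e' => ((Λ.ω₁ : ℂ) • σ) (is e') -
    ∑ b, (κM e' b : ℂ) * ((v b : ℂ) * (L (cls b)).η₁ + ((0 : γ → ℤ) b : ℂ) * (L (cls b)).η₂) with hc₁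
  set c₂ : δ → ℂ := fun e' => ((Λ.ω₂ : ℂ) • σ) (is e') -
    ∑ b, (κM e' b : ℂ) * (((0 : γ → ℤ) b : ℂ) * (L (cls b)).η₁ + (v b : ℂ) * (L (cls b)).η₂) with hc₂
  have h1 : coords (0 : β → ℂ) (0 : γ → ℂ) c₁ ∈ 𝔥 :=
    sEmb_sub_mem_linSpace L cls κM M e hΘ hH (Submodule.smul_mem _ (Λ.ω₁ : ℂ) hσ) v 0 fun b => by
      simp only [Pi.smul_apply, smul_eq_mul, hσz b, Pi.zero_apply, Int.cast_zero, zero_mul, add_zero]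
      rw [hvf PeriodPair.ω₁ b]; ring
  have h2 : coords (0 : β → ℂ) (0 : γ → ℂ) c₂ ∈ 𝔥 :=
    sEmb_sub_mem_linSpace L cls κM M e hΘ hH (Submodule.smul_mem _ (Λ.ω₂ : ℂ) hσ) 0 v fun b => by
      simp only [Pi.smul_apply, smul_eq_mul, hσz b, Pi.zero_apply, Int.cast_zero, zero_mul, zero_add]
      rw [hvf PeriodPair.ω₂ b]; ring
  have hc₁e : ∀ e', c₁ e' = Λ.ω₁ * σ (is e') - Λ.η₁ * kappaVec κM (intVec v) e' := by
    intro e'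
    simp only [hc₁, Pi.smul_apply, smul_eq_mul, kappaVec, intVec, Pi.zero_apply, Int.cast_zero, zero_mul, add_zero,
      Finset.mul_sum]
    congr 1
    exact Finset.sum_congr rfl fun b _ => by rw [hvf PeriodPair.η₁ b]; ring
  have hc₂e : ∀ e', c₂ e' = Λ.ω₂ * σ (is e') - Λ.η₂ * kappaVec κM (intVec v) e' := by
    intro e'
    simp only [hc₂, Pi.smul_apply, smul_eq_mul, kappaVec, intVec, Pi.zero_apply, Int.cast_zero, zero_mul, zero_add,
      Finset.mul_sum]
    congr 1
    exact Finset.sum_congr rfl fun b _ => by rw [hvf PeriodPair.η₂ b]; ring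
  have hκ : coords (0 : β → ℂ) (0 : γ → ℂ) (kappaVec κM (intVec v)) =
      D⁻¹ • ((Λ.ω₂ : ℂ) • coords (0 : β → ℂ) (0 : γ → ℂ) c₁ - (Λ.ω₁ : ℂ) • coords (0 : β → ℂ) (0 : γ → ℂ) c₂) := by
    rw [← coords_smul, ← coords_smul, ← coords_sub, ← coords_smul, smul_zero, smul_zero, smul_zero, smul_zero,
      sub_zero, sub_zero, smul_zero, smul_zero]
    congr 1
    funext e'
    simp only [Pi.smul_apply, Pi.sub_apply, smul_eq_mul, hc₁e, hc₂e]
    field_simp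
    ring
  have hs : coords (0 : β → ℂ) (0 : γ → ℂ) (sPart σ) =
      D⁻¹ • ((Λ.η₂ : ℂ) • coords (0 : β → ℂ) (0 : γ → ℂ) c₁ - (Λ.η₁ : ℂ) • coords (0 : β → ℂ) (0 : γ → ℂ) c₂) := by
    rw [← coords_smul, ← coords_smul, ← coords_sub, ← coords_smul, smul_zero, smul_zero, smul_zero, smul_zero,
      sub_zero, sub_zero, smul_zero, smul_zero]
    congr 1
    funext e'
    simp only [Pi.smul_apply, Pi.sub_apply, smul_eq_mul, hc₁e, hc₂e, sPart]
    field_simp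
    ring
  refine ⟨?_, ?_⟩
  · rw [hκ]; exact Submodule.smul_mem _ _ (Submodule.sub_mem _ (Submodule.smul_mem _ _ h1) (Submodule.smul_mem _ _ h2))
  · rw [hs]; exact Submodule.smul_mem _ _ (Submodule.sub_mem _ (Submodule.smul_mem _ _ h1) (Submodule.smul_mem _ _ h2))

/-- **The torus datum of an integer vector of `𝔷₀` translates `H` into itself**:
`(ω_i y(σ'), 0, 0) ∈ H` for the lift `σ' = (y, v, 0) ∈ 𝒯(H)` of `v` (it is `ω_i σ'` minus the kernel
vector over `ω_i v` plus `(0, 0, η_i κ v) ∈ 𝒯(H)`). [folklore] -/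
theorem coords_omega_smul_yPart_mem {H : AddSubgroup (β ⊕ (γ ⊕ δ) → ℂ)}
    (hH : M.IsClosedG (H : Set (β ⊕ (γ ⊕ δ) → ℂ))) {σ : β ⊕ (γ ⊕ δ) → ℂ}
    (hσ : σ ∈ AnalyticGroupModel.linSpace (H : Set (β ⊕ (γ ⊕ δ) → ℂ))) (v : γ → ℤ) {i : 𝓙}
    (hvi : ∀ b, cls b ≠ i → v b = 0) (hσz : ∀ b, σ (iz b) = (v b : ℂ))
    (hσs : ∀ e', σ (is e') = 0) :
    coords (((L i).ω₁ : ℂ) • yPart σ) (0 : γ → ℂ) (0 : δ → ℂ) ∈ H ∧ coords (((L i).ω₂ : ℂ) • yPart σ) (0 : γ → ℂ) (0 : δ → ℂ) ∈ H := by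
  have hκ := (kappaVec_mem_of_int_lift L cls κM M e hΘ hH hσ v hvi hσz).1
  set Λ := L i with hΛ
  have hvf : ∀ (f : PeriodPair → ℂ) (b : γ), (v b : ℂ) * f (L (cls b)) = (v b : ℂ) * f Λ := by
    intro f b
    by_cases hb : cls b = i
    · rw [hΛ, ← hb]
    · rw [hvi b hb, Int.cast_zero, zero_mul, zero_mul]
  have hker : ∀ m n : γ → ℤ, coords (0 : β → ℂ) (fun b => (m b : ℂ) * (L (cls b)).ω₁ + (n b : ℂ) * (L (cls b)).ω₂)
      (fun e' => ∑ b, (κM e' b : ℂ) * ((m b : ℂ) * (L (cls b)).η₁ + (n b : ℂ) * (L (cls b)).η₂)) ∈ H :=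
    fun m n => ker_subset_of_isClosedG L cls κM M e hΘ hH (coords_lattice_mem_ker L cls κM m n)
  have h𝔥H : ∀ x ∈ AnalyticGroupModel.linSpace (H : Set (β ⊕ (γ ⊕ δ) → ℂ)), x ∈ H := fun x hx => by
    have := AnalyticGroupModel.linSpace_subset H hx
    exact this
  -- the `η` of the lattice vectors `ω₁ v`, `ω₂ v` of `Λ_γ` (supported in the class `i`)
  have hs1 : ∀ e', ∑ x, (κM e' x : ℂ) * (v x : ℂ) * (L (cls x)).η₁ = Λ.η₁ * kappaVec κM (intVec v) e' := by
    intro e'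
    simp only [kappaVec, intVec, Finset.mul_sum]
    exact Finset.sum_congr rfl fun b _ => by rw [mul_assoc, hvf PeriodPair.η₁ b]; ring
  have hs2 : ∀ e', ∑ x, (κM e' x : ℂ) * (v x : ℂ) * (L (cls x)).η₂ = Λ.η₂ * kappaVec κM (intVec v) e' := by
    intro e'
    simp only [kappaVec, intVec, Finset.mul_sum]
    exact Finset.sum_congr rfl fun b _ => by rw [mul_assoc, hvf PeriodPair.η₂ b]; ring
  constructor
  · have hdec : coords ((Λ.ω₁ : ℂ) • yPart σ) (0 : γ → ℂ) (0 : δ → ℂ) =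
        (Λ.ω₁ : ℂ) • σ - coords (0 : β → ℂ) (fun b => (v b : ℂ) * (L (cls b)).ω₁ + ((0 : γ → ℤ) b : ℂ) * (L (cls b)).ω₂)
          (fun e' => ∑ b, (κM e' b : ℂ) * ((v b : ℂ) * (L (cls b)).η₁ + ((0 : γ → ℤ) b : ℂ) * (L (cls b)).η₂)) +
        (Λ.η₁ : ℂ) • coords (0 : β → ℂ) (0 : γ → ℂ) (kappaVec κM (intVec v)) := by
      funext k; rcases k with j | b | e'
      · change coords ((Λ.ω₁ : ℂ) • yPart σ) (0 : γ → ℂ) (0 : δ → ℂ) (iy j) = ((Λ.ω₁ : ℂ) • σ - coords (0 : β → ℂ) (fun b => (v b : ℂ) * (L (cls b)).ω₁ + ((0 : γ → ℤ) b : ℂ) * (L (cls b)).ω₂) (fun e' => ∑ b, (κM e' b : ℂ) * ((v b : ℂ) * (L (cls b)).η₁ + ((0 : γ → ℤ) b : ℂ) * (L (cls b)).η₂)) + (Λ.η₁ : ℂ) • coords (0 : β → ℂ) (0 : γ → ℂ) (kappaVec κM (intVec v))) (iy j)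
        simp [yPart]
      · change coords ((Λ.ω₁ : ℂ) • yPart σ) (0 : γ → ℂ) (0 : δ → ℂ) (iz b) = ((Λ.ω₁ : ℂ) • σ - coords (0 : β → ℂ) (fun b => (v b : ℂ) * (L (cls b)).ω₁ + ((0 : γ → ℤ) b : ℂ) * (L (cls b)).ω₂) (fun e' => ∑ b, (κM e' b : ℂ) * ((v b : ℂ) * (L (cls b)).η₁ + ((0 : γ → ℤ) b : ℂ) * (L (cls b)).η₂)) + (Λ.η₁ : ℂ) • coords (0 : β → ℂ) (0 : γ → ℂ) (kappaVec κM (intVec v))) (iz b)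
        simp only [coords_iz, Pi.add_apply, Pi.sub_apply, Pi.smul_apply, smul_eq_mul, Pi.zero_apply, hσz b,
          Int.cast_zero, zero_mul, add_zero]
        rw [hvf PeriodPair.ω₁ b]; ring
      · change coords ((Λ.ω₁ : ℂ) • yPart σ) (0 : γ → ℂ) (0 : δ → ℂ) (is e') = ((Λ.ω₁ : ℂ) • σ - coords (0 : β → ℂ) (fun b => (v b : ℂ) * (L (cls b)).ω₁ + ((0 : γ → ℤ) b : ℂ) * (L (cls b)).ω₂) (fun e' => ∑ b, (κM e' b : ℂ) * ((v b : ℂ) * (L (cls b)).η₁ + ((0 : γ → ℤ) b : ℂ) * (L (cls b)).η₂)) + (Λ.η₁ : ℂ) • coords (0 : β → ℂ) (0 : γ → ℂ) (kappaVec κM (intVec v))) (is e')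
        simp only [coords_is, Pi.add_apply, Pi.sub_apply, Pi.smul_apply, smul_eq_mul, Pi.zero_apply, hσs e',
          Int.cast_zero, zero_mul, add_zero, ← mul_assoc]
        rw [hs1 e']; ring
    rw [hdec]
    exact H.add_mem (H.sub_mem (h𝔥H _ (Submodule.smul_mem _ _ hσ)) (hker v 0)) (h𝔥H _ (Submodule.smul_mem _ _ hκ))
  · have hdec : coords ((Λ.ω₂ : ℂ) • yPart σ) (0 : γ → ℂ) (0 : δ → ℂ) =
        (Λ.ω₂ : ℂ) • σ - coords (0 : β → ℂ) (fun b => ((0 : γ → ℤ) b : ℂ) * (L (cls b)).ω₁ + (v b : ℂ) * (L (cls b)).ω₂)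
          (fun e' => ∑ b, (κM e' b : ℂ) * (((0 : γ → ℤ) b : ℂ) * (L (cls b)).η₁ + (v b : ℂ) * (L (cls b)).η₂)) +
        (Λ.η₂ : ℂ) • coords (0 : β → ℂ) (0 : γ → ℂ) (kappaVec κM (intVec v)) := by
      funext k; rcases k with j | b | e'
      · change coords ((Λ.ω₂ : ℂ) • yPart σ) (0 : γ → ℂ) (0 : δ → ℂ) (iy j) = ((Λ.ω₂ : ℂ) • σ - coords (0 : β → ℂ) (fun b => ((0 : γ → ℤ) b : ℂ) * (L (cls b)).ω₁ + (v b : ℂ) * (L (cls b)).ω₂) (fun e' => ∑ b, (κM e' b : ℂ) * (((0 : γ → ℤ) b : ℂ) * (L (cls b)).η₁ + (v b : ℂ) * (L (cls b)).η₂)) + (Λ.η₂ : ℂ) • coords (0 : β → ℂ) (0 : γ → ℂ) (kappaVec κM (intVec v))) (iy j)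
        simp [yPart]
      · change coords ((Λ.ω₂ : ℂ) • yPart σ) (0 : γ → ℂ) (0 : δ → ℂ) (iz b) = ((Λ.ω₂ : ℂ) • σ - coords (0 : β → ℂ) (fun b => ((0 : γ → ℤ) b : ℂ) * (L (cls b)).ω₁ + (v b : ℂ) * (L (cls b)).ω₂) (fun e' => ∑ b, (κM e' b : ℂ) * (((0 : γ → ℤ) b : ℂ) * (L (cls b)).η₁ + (v b : ℂ) * (L (cls b)).η₂)) + (Λ.η₂ : ℂ) • coords (0 : β → ℂ) (0 : γ → ℂ) (kappaVec κM (intVec v))) (iz b)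
        simp only [coords_iz, Pi.add_apply, Pi.sub_apply, Pi.smul_apply, smul_eq_mul, Pi.zero_apply, hσz b,
          Int.cast_zero, zero_mul, zero_add]
        rw [hvf PeriodPair.ω₂ b]; ring
      · change coords ((Λ.ω₂ : ℂ) • yPart σ) (0 : γ → ℂ) (0 : δ → ℂ) (is e') = ((Λ.ω₂ : ℂ) • σ - coords (0 : β → ℂ) (fun b => ((0 : γ → ℤ) b : ℂ) * (L (cls b)).ω₁ + (v b : ℂ) * (L (cls b)).ω₂) (fun e' => ∑ b, (κM e' b : ℂ) * (((0 : γ → ℤ) b : ℂ) * (L (cls b)).η₁ + (v b : ℂ) * (L (cls b)).η₂)) + (Λ.η₂ : ℂ) • coords (0 : β → ℂ) (0 : γ → ℂ) (kappaVec κM (intVec v))) (is e')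
        simp only [coords_is, Pi.add_apply, Pi.sub_apply, Pi.smul_apply, smul_eq_mul, Pi.zero_apply, hσs e',
          Int.cast_zero, zero_mul, zero_add, ← mul_assoc]
        rw [hs2 e']; ring
    rw [hdec]
    exact H.add_mem (H.sub_mem (h𝔥H _ (Submodule.smul_mem _ _ hσ)) (hker 0 v)) (h𝔥H _ (Submodule.smul_mem _ _ hκ))

/-- **Compatibility and splitting.** Assume the `E`-projection `𝔷₀ = z'(𝒯(H))` is spanned by
integer vectors lying in it (`hT`, `hspan`). Then for every `ζ ∈ 𝔷₀`: `(0, 0, κζ) ∈ 𝒯(H)`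
(compatibility of the vector part with the abelian part) and `(0, ζ, 0) ∈ 𝒯(H)` (splitting).
Proof for an integer `v`: lift, remove the vector part (`kappaVec_mem_of_int_lift`), and move the
torus part `y` into `yDir` by the Artin move on the subgroup generated by the `ω_i y`
(`coords_omega_smul_yPart_mem`; a character of `ℤ^β` trivial on `ω₁y, ω₂y` kills `y` since
`ω₂/ω₁ ∉ ℝ`). [folklore] -/
theorem kappaVec_mem_and_zEmb_mem {H : AddSubgroup (β ⊕ (γ ⊕ δ) → ℂ)}
    (hH : M.IsClosedG (H : Set (β ⊕ (γ ⊕ δ) → ℂ))) (T : Set (γ → ℤ))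
    (hTcls : ∀ v ∈ T, ∃ i, ∀ b, cls b ≠ i → v b = 0)
    (hT : ∀ v ∈ T, intVec v ∈ (AnalyticGroupModel.linSpace (H : Set (β ⊕ (γ ⊕ δ) → ℂ))).map zProj)
    (hspan : (AnalyticGroupModel.linSpace (H : Set (β ⊕ (γ ⊕ δ) → ℂ))).map zProj ≤ Submodule.span ℂ (intVec '' T))
    {ζ : γ → ℂ} (hζ : ζ ∈ (AnalyticGroupModel.linSpace (H : Set (β ⊕ (γ ⊕ δ) → ℂ))).map zProj) :
    coords (0 : β → ℂ) (0 : γ → ℂ) (kappaVec κM ζ) ∈ AnalyticGroupModel.linSpace (H : Set (β ⊕ (γ ⊕ δ) → ℂ)) ∧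
      coords (0 : β → ℂ) ζ (0 : δ → ℂ) ∈ AnalyticGroupModel.linSpace (H : Set (β ⊕ (γ ⊕ δ) → ℂ)) := by
  classical
  set 𝔥 := AnalyticGroupModel.linSpace (H : Set (β ⊕ (γ ⊕ δ) → ℂ)) with h𝔥
  -- lifts of the integer vectors with vanishing vector part
  have hlift : ∀ v ∈ T, ∃ σ ∈ 𝔥, (∀ b, σ (iz b) = (v b : ℂ)) ∧ ∀ e', σ (is e') = 0 := by
    intro v hv
    obtain ⟨σ, hσ, hσz⟩ := Submodule.mem_map.mp (hT v hv)
    have hσb : ∀ b, σ (iz b) = (v b : ℂ) := fun b => by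
      have := congrFun hσz b; simpa [intVec] using this
    obtain ⟨i, hvi⟩ := hTcls v hv
    have hs := (kappaVec_mem_of_int_lift L cls κM M e hΘ hH hσ v hvi hσb).2
    refine ⟨σ - coords (0 : β → ℂ) (0 : γ → ℂ) (sPart σ), Submodule.sub_mem _ hσ hs, fun b => by simp [hσb b],
      fun e' => by simp [sPart]⟩
  -- the subgroup of the torus data `ω_i y(σ_v)`
  set Γ : AddSubgroup (β → ℂ) := AddSubgroup.closure
    {g | ∃ σ ∈ 𝔥, ∃ i : 𝓙, (∃ v ∈ T, (∀ b, cls b ≠ i → v b = 0) ∧ ∀ b, σ (iz b) = (v b : ℂ)) ∧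
      (∀ e', σ (is e') = 0) ∧ (g = ((L i).ω₁ : ℂ) • yPart σ ∨ g = ((L i).ω₂ : ℂ) • yPart σ)} with hΓ
  have hΓH : ∀ g ∈ Γ, coords g (0 : γ → ℂ) (0 : δ → ℂ) ∈ H := by
    intro g hg
    have : Γ ≤ H.comap (yEmb (γ := γ) (δ := δ)).toAddMonoidHom := by
      rw [hΓ, AddSubgroup.closure_le]
      rintro g ⟨σ, hσ, i, ⟨v, -, hvi, hσz⟩, hσs, hg⟩
      obtain ⟨h1, h2⟩ := coords_omega_smul_yPart_mem L cls κM M e hΘ hH hσ v hvi hσz hσs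
      rcases hg with rfl | rfl
      · exact h1
      · exact h2
    exact this hg
  -- Artin: `charPerp Γ ⊆ yDir 𝔥`
  have hArtin : ∀ θ ∈ charPerp (β := β) Γ, coords θ (0 : γ → ℂ) (0 : δ → ℂ) ∈ 𝔥 := by
    intro θ hθ
    refine mem_linSpace_of_forall_thetaEval L cls κM M e hΘ hH fun D P _ hvan w hw t => ?_
    have h := thetaEval_eq_zero_of_forall_mem_addSubgroup L cls κM P (w := w) Γ
      (fun g hg => hvan _ (H.add_mem hw (hΓH g hg))) (Submodule.smul_mem _ t hθ)
    have hv : t • coords θ (0 : γ → ℂ) (0 : δ → ℂ) = coords (t • θ) (0 : γ → ℂ) (0 : δ → ℂ) := by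
      rw [← coords_smul, smul_zero, smul_zero]
    rw [hv]
    exact h
  -- the torus datum of each lift lies in `charPerp Γ`
  have hsplit : ∀ v ∈ T, coords (0 : β → ℂ) (intVec v) (0 : δ → ℂ) ∈ 𝔥 := by
    intro v hv
    obtain ⟨i, hvi⟩ := hTcls v hv
    obtain ⟨σ, hσ, hσz, hσs⟩ := hlift v hv
    have hy : yPart σ ∈ charPerp (β := β) Γ := by
      rw [mem_charPerp_iff]
      intro q hq
      have hgen : ∀ ω : ℂ, (ω = (L i).ω₁ ∨ ω = (L i).ω₂) →
          ∃ k : ℤ, (∑ j, (q j : ℂ) * yPart σ j) * ω = k * (2 * Real.pi * I) := by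
        intro ω hω
        have hmem : ω • yPart σ ∈ Γ := by
          refine AddSubgroup.subset_closure ⟨σ, hσ, i, ⟨v, hv, hvi, hσz⟩, hσs, ?_⟩
          rcases hω with rfl | rfl
          · exact Or.inl rfl
          · exact Or.inr rfl
        obtain ⟨k, hk⟩ := Complex.exp_eq_one_iff.mp (hq _ hmem)
        refine ⟨k, ?_⟩
        rw [← hk, Finset.sum_mul]
        exact Finset.sum_congr rfl fun j _ => by simp; ring
      exact eq_zero_of_mul_omega_mem_two_pi_I (L i) (hgen _ (Or.inl rfl)) (hgen _ (Or.inr rfl))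
    have hyθ := hArtin _ hy
    have hdec : coords (0 : β → ℂ) (intVec v) (0 : δ → ℂ) = σ - coords (yPart σ) (0 : γ → ℂ) (0 : δ → ℂ) := by
      funext k; rcases k with j | b | e'
      · change coords (0 : β → ℂ) (intVec v) (0 : δ → ℂ) (iy j) = (σ - coords (yPart σ) (0 : γ → ℂ) (0 : δ → ℂ)) (iy j)
        simp [yPart]
      · change coords (0 : β → ℂ) (intVec v) (0 : δ → ℂ) (iz b) = (σ - coords (yPart σ) (0 : γ → ℂ) (0 : δ → ℂ)) (iz b)
        simp [intVec, hσz b]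
      · change coords (0 : β → ℂ) (intVec v) (0 : δ → ℂ) (is e') = (σ - coords (yPart σ) (0 : γ → ℂ) (0 : δ → ℂ)) (is e')
        simp [hσs e']
    rw [hdec]
    exact Submodule.sub_mem _ hσ hyθ
  have hκint : ∀ v ∈ T, coords (0 : β → ℂ) (0 : γ → ℂ) (kappaVec κM (intVec v)) ∈ 𝔥 := by
    intro v hv
    obtain ⟨i, hvi⟩ := hTcls v hv
    obtain ⟨σ, hσ, hσz, -⟩ := hlift v hv
    exact (kappaVec_mem_of_int_lift L cls κM M e hΘ hH hσ v hvi hσz).1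
  -- pass to the span
  have hζspan : ζ ∈ Submodule.span ℂ (intVec '' T) := hspan hζ
  constructor
  · have hle : Submodule.span ℂ (intVec '' T) ≤ 𝔥.comap ((sEmb (β := β) (γ := γ)).comp (kappaVecₗ κM)) := by
      refine Submodule.span_le.mpr ?_
      rintro _ ⟨v, hv, rfl⟩
      exact hκint v hv
    exact hle hζspan
  · have hle : Submodule.span ℂ (intVec '' T) ≤ 𝔥.comap (zEmb (β := β) (δ := δ)) := by
      refine Submodule.span_le.mpr ?_
      rintro _ ⟨v, hv, rfl⟩
      exact hsplit v hv
    exact hle hζspan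

end Model

end Std

end GaGmEFam

end Literature.NumberTheory.Transcendental

end
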